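import Literature.Geometry.Kaehler.ComplexTorusLinearSystemHyperplaneSections
import HarnessLib

/-!
# The base locus `Bs|L|` of a complete linear system on a complex torus is an analytic subset:
# `Bs|L| = ⋂_j |(ϑ_j)|` over a basis (or any spanning family) of `H⁰(L)`, with empty interior iff
# `H⁰(L) ≠ 0`

[tag: lange-cav-complex-tori] [linked: HodgeConjecture (lit-hodgefound SKELETON §A2, row A2-165)]

Layer `Literature/Geometry/Kaehler`, namespace `Literature.Geometry.Kaehler.ComplexTorus`; lane
`lit-hodgefound` (Track 2 foundations library), skeleton seat `lit-hodgefound-skel-2` (generation 39),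
plan row A2-165 (pointer (40) of the seat programme). Sequel of A2-151 (`ComplexTorusLinearSystemBaseLocus`:
`baseLocus Φ d η χ = ⋂_{D ∈ |L|} |D|`, `cover_mem_baseLocus_iff`, `isClosed_baseLocus`), A2-158
(`cover_mem_support_divisorChain_iff`: `π v ∈ |(ϑ)| ⟺ ϑ(v) = 0`), A2-145/A2-150 (`support_divisorChain`,
`support_divisorChain_eq_image`) and of the analytic-set layer (`isAnalyticSet_biInter_finset`,
`HolomorphicChain.isAnalyticSet_support`, `interior_eq_empty_of_hasPureCodim`). Theorems only; no
definition, no named fact.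

Sources, VERBATIM. P. Griffiths, J. Harris, *Principles of Algebraic Geometry* (1978), Ch. 1 §1
[p. 137]: "the base locus of a linear system is the intersection of the divisors in the system";
R. Hartshorne, *Algebraic Geometry* (1977), II §7 [p0202 L10 / Lemma 7.8]: "`s₀, …, s_n ∈ Γ(X, L)`
[…] generate `L`" iff they have no common zero; H. Lange, *Abelian Varieties over the Complex Numbers*
(2023) [held `book:lange1992-complex-abelian-varieties`], §2.1.1 [p0077 L19–L26]: "`φ_L(v̄) =
(ϑ₀(v) : ⋯ : ϑ_n(v))` […] If `σ_ν(x) = 0` for all `ν`, then `φ_L` is not defined at `x`" (with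
`ϑ₀, …, ϑ_n` a basis of `H⁰(L)`); E. M. Chirka, *Complex Analytic Sets* (1989), §2.8 (p. 25: a proper
analytic subset has empty interior), §4.1 (finite intersections of analytic sets are analytic).

## Contents

* §1 **`baseLocus_eq_iInter_support_divisorChain`**: `Bs|L| = ⋂_j |(ϑ_j)|` for every finite or
  infinite family `ϑ_j ∈ H⁰(L) ∖ 0` SPANNING `H⁰(L)` (it suffices to intersect the divisors of a
  basis: "`σ_ν(x) = 0` for all `ν`"); `baseLocus_eq_iInter_support_divisorChain_basis`;
  `exists_finset_baseLocus_eq_biInter` (`Bs|L|` is cut out by `≤ h⁰(L)` members of `|L|`).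
* §2 **`isAnalyticSet_baseLocus`** (a finite intersection of supports of divisors),
  `isCompact_baseLocus`.
* §3 `interior_support_divisorChain_eq_empty` (`|(ϑ)|` is a hypersurface or empty),
  **`interior_baseLocus_eq_empty`** (`H⁰(L) ≠ 0`), `dense_compl_baseLocus`,
  **`baseLocus_eq_univ_iff`** (`Bs|L| = X ⟺ H⁰(L) = 0`), `baseLocus_ne_univ`.

## References

* [GriffithsHarris1978] P. Griffiths, J. Harris, *Principles of Algebraic Geometry* (1978), Ch. 1 §1 (p. 137).
* [Hartshorne1977] R. Hartshorne, *Algebraic Geometry* (1977), II §7 (p. 158), Lemma 7.8.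
* [Lange2023AbelianVarietiesComplex] H. Lange, *Abelian Varieties over the Complex Numbers* (2023), §2.1.1 (p. 77).
* [Chirka1989] E. M. Chirka, *Complex Analytic Sets* (1989), §2.8 (p. 25), §4.1.
-/

noncomputable section

open scoped Manifold Pointwise
open Set Function Module

namespace Literature.Geometry.Kaehler.ComplexTorus

universe u

section BaseLocusAnalytic

variable {ι : Type*} [Fintype ι] {E : Type u} [NormedAddCommGroup E] [InnerProductSpace ℂ E]
  [FiniteDimensional ℂ E] (Φ : (ι → ℝ) ≃L[ℝ] E) (d : ℕ) {n : ℕ} (e : Fin n ≃ ι) (h : 2 * d + 2 = n)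
  {η : E [⋀^Fin 2]→L[ℝ] ℝ} {χ : (ι → ℤ) → ℂ}

/-! ### §1 `Bs|L| = ⋂_j |(ϑ_j)|` over a spanning family -/

include e h in
/-- **`Bs|L| = ⋂_j |(ϑ_j)|` FOR ANY FAMILY OF NON-ZERO SECTIONS `ϑ_j` SPANNING `H⁰(L)`** ("the base
locus of a linear system is the intersection of the divisors in the system" — it suffices to intersect
the divisors of a spanning family: all sections vanish at `v` iff the `ϑ_j` do).
[cite: GriffithsHarris1978, Ch. 1 §1 (p. 137)] [cite: Lange2023AbelianVarietiesComplex, §2.1.1 (p0077 L19–L26: "`σ_ν(x) = 0` for all `ν`")] -/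
theorem baseLocus_eq_iInter_support_divisorChain (hη : IsNSForm Φ η) (hχ : IsSemicharacter Φ η χ)
    {κ : Type*} {θ : κ → E → ℂ} (hθ : ∀ j, θ j ∈ thetaFunctions Φ (canonicalFactor Φ η χ))
    (hθ0 : ∀ j, θ j ≠ 0)
    (hspan : thetaFunctions Φ (canonicalFactor Φ η χ) ≤ Submodule.span ℂ (Set.range θ)) :
    baseLocus Φ d η χ = ⋂ j, (divisorChain Φ d (θ j)).support := by
  ext x
  obtain ⟨v, rfl⟩ := cover_surjective Φ x
  rw [cover_mem_baseLocus_iff Φ d e h hη hχ v, mem_iInter]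
  constructor
  · intro hv j
    exact (cover_mem_support_divisorChain_iff Φ d e h hη hχ (hθ j) (hθ0 j) v).2 (hv _ (hθ j))
  · intro hv ϑ hϑ
    have hv' : ∀ j, θ j v = 0 := fun j =>
      (cover_mem_support_divisorChain_iff Φ d e h hη hχ (hθ j) (hθ0 j) v).1 (hv j)
    -- `ϑ` lies in the span of the `θ_j`, all of which vanish at `v`
    refine Submodule.span_induction (p := fun f _ => f v = 0) ?_ ?_ ?_ ?_ (hspan hϑ)
    · rintro _ ⟨j, rfl⟩
      exact hv' j
    · rfl
    · intro f g _ _ hf hg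
      rw [Pi.add_apply, hf, hg, add_zero]
    · intro c f _ hf
      rw [Pi.smul_apply, hf, smul_zero]

include e h in
/-- **`Bs|L| = ⋂_i |(ϑ_i)|` FOR A BASIS `(ϑ_i)` OF `H⁰(L)`** ("`φ_L(v̄) = (ϑ₀(v) : ⋯ : ϑ_n(v))` […]
If `σ_ν(x) = 0` for all `ν`, then `φ_L` is not defined at `x`"). For `H⁰(L) = 0` the index type is
empty and both sides are `X`. [cite: Lange2023AbelianVarietiesComplex, §2.1.1 (p0077 L19–L26)] [cite: GriffithsHarris1978, Ch. 1 §1 (p. 137)] -/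
theorem baseLocus_eq_iInter_support_divisorChain_basis (hη : IsNSForm Φ η) (hχ : IsSemicharacter Φ η χ)
    {κ : Type*} (b : Basis κ ℂ (thetaFunctions Φ (canonicalFactor Φ η χ))) :
    baseLocus Φ d η χ = ⋂ i, (divisorChain Φ d (b i : E → ℂ)).support := by
  refine baseLocus_eq_iInter_support_divisorChain Φ d e h hη hχ (fun i => (b i).2)
    (fun i h0 => b.ne_zero i (Subtype.ext h0)) fun ϑ hϑ => ?_
  -- `ϑ = Σ cᵢ bᵢ` lies in the span of the coerced basis vectors
  have hmem : (⟨ϑ, hϑ⟩ : thetaFunctions Φ (canonicalFactor Φ η χ)) ∈ Submodule.span ℂ (Set.range b) := by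
    rw [b.span_eq]
    exact Submodule.mem_top
  have himage := Submodule.mem_map_of_mem
    (f := (thetaFunctions Φ (canonicalFactor Φ η χ)).subtype) hmem
  rw [Submodule.map_span, ← Set.range_comp] at himage
  exact himage

include e h in
/-- **`Bs|L|` IS CUT OUT BY FINITELY MANY MEMBERS OF `|L|`**: there is a finite set `S ⊆ |L|` of
divisors (the divisors of a basis of `H⁰(L)`, `#S ≤ h⁰(L)`) with `Bs|L| = ⋂_{D ∈ S} |D|`.
[cite: GriffithsHarris1978, Ch. 1 §1 (p. 137: "the base locus of a linear system is the intersection of the divisors in the system")] [cite: Lange2023AbelianVarietiesComplex, §2.1.1 (p0077 L19–L26)] -/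
theorem exists_finset_baseLocus_eq_biInter (hη : IsNSForm Φ η) (hχ : IsSemicharacter Φ η χ) :
    ∃ S : Finset (HolomorphicChain 𝓘(ℂ, E) (ComplexTorus Φ) d),
      ↑S ⊆ linearSystem Φ d η χ ∧ S.card ≤ finrank ℂ (thetaFunctions Φ (canonicalFactor Φ η χ)) ∧
        baseLocus Φ d η χ = ⋂ D ∈ S, D.support := by
  classical
  haveI := finiteDimensional_thetaFunctions (isFactor_canonicalFactor Φ hη hχ)
  set b := Module.finBasis ℂ (thetaFunctions Φ (canonicalFactor Φ η χ)) with hb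
  refine ⟨Finset.univ.image fun i => divisorChain Φ d (b i : E → ℂ), ?_, ?_, ?_⟩
  · intro D hD
    rw [Finset.coe_image] at hD
    obtain ⟨i, -, rfl⟩ := hD
    exact divisorChain_mem_linearSystem Φ d (b i).2 fun h0 => b.ne_zero i (Subtype.ext h0)
  · exact Finset.card_image_le.trans (by rw [Finset.card_univ, Fintype.card_fin])
  · rw [baseLocus_eq_iInter_support_divisorChain_basis Φ d e h hη hχ b]
    ext x
    simp only [mem_iInter, Finset.mem_image, Finset.mem_univ, true_and, forall_exists_index,
      forall_apply_eq_imp_iff]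

/-! ### §2 The base locus is an analytic subset -/

include e h in
/-- **THE BASE LOCUS `Bs|L(H, χ)|` IS AN ANALYTIC SUBSET OF `X`** — a finite intersection
`⋂_{i ≤ N} |(ϑ_i)|` of supports of divisors over a basis `ϑ₀, …, ϑ_N` of the finite-dimensional
`H⁰(L)` (all of `X` when `H⁰(L) = 0`). [cite: GriffithsHarris1978, Ch. 1 §1 (p. 137)] [cite: Chirka1989, §4.1 (finite intersections of analytic sets)] -/
theorem isAnalyticSet_baseLocus (hη : IsNSForm Φ η) (hχ : IsSemicharacter Φ η χ) :
    IsAnalyticSet 𝓘(ℂ, E) (baseLocus Φ d η χ) := by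
  haveI := finiteDimensional_thetaFunctions (isFactor_canonicalFactor Φ hη hχ)
  rw [baseLocus_eq_iInter_support_divisorChain_basis Φ d e h hη hχ
    (Module.finBasis ℂ (thetaFunctions Φ (canonicalFactor Φ η χ)))]
  have hset : (⋂ i, (divisorChain Φ d ((Module.finBasis ℂ (thetaFunctions Φ (canonicalFactor Φ η χ))) i :
      E → ℂ)).support) =
      ⋂ i ∈ (Finset.univ : Finset (Fin (finrank ℂ (thetaFunctions Φ (canonicalFactor Φ η χ))))),
        (divisorChain Φ d ((Module.finBasis ℂ (thetaFunctions Φ (canonicalFactor Φ η χ))) i :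
          E → ℂ)).support := by
    simp only [Finset.mem_univ, iInter_true]
  rw [hset]
  exact isAnalyticSet_biInter_finset _ fun i _ => (divisorChain Φ d _).isAnalyticSet_support

/-- The base locus is compact (closed in the compact torus). [cite: GriffithsHarris1978, Ch. 1 §1 (p. 137)] -/
theorem isCompact_baseLocus : IsCompact (baseLocus Φ d η χ) :=
  (isClosed_baseLocus Φ d).isCompact

/-! ### §3 `Bs|L|` has empty interior iff `H⁰(L) ≠ 0` -/

include e h in
/-- **The support `|(ϑ)|` of the divisor of a section has empty interior** — it is an analytic
hypersurface of `X` (when `ϑ` vanishes somewhere) or empty. [cite: Chirka1989, §2.8 (p. 25)] [cite: Lange2023AbelianVarietiesComplex, §2.1.1 (p. 78 L1–L2)] -/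
theorem interior_support_divisorChain_eq_empty (hη : IsNSForm Φ η) (hχ : IsSemicharacter Φ η χ)
    {ϑ : E → ℂ} (hϑ : ϑ ∈ thetaFunctions Φ (canonicalFactor Φ η χ)) (hϑ0 : ϑ ≠ 0) :
    interior (divisorChain Φ d ϑ).support = ∅ := by
  have hdim : finrank ℂ E = d + 1 := finrank_eq_succ_of_rank Φ e h
  by_cases hz : ∃ v, ϑ v = 0
  · obtain ⟨Y, hY, hYϑ⟩ := exists_hasPureDim_preimage_eq_of_thetaFunction Φ
      (isFactor_canonicalFactor Φ hη hχ) hϑ hϑ0 hz hdim.symm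
    rw [support_divisorChain Φ d e h hη hχ hϑ hϑ0 hY hYϑ]
    have hYc : HasPureCodim 𝓘(ℂ, E) Y 1 := by
      have := hY.hasPureCodim
      rwa [hdim, show d + 1 - d = 1 by omega] at this
    exact interior_eq_empty_of_hasPureCodim hYc
  · push Not at hz
    rw [support_divisorChain_eq_image Φ d e h hη hχ hϑ hϑ0]
    have h0 : {w | ϑ w = 0} = ∅ := eq_empty_of_forall_notMem fun w hw => hz w hw
    rw [h0, image_empty, interior_empty]

include e h in
/-- **FOR `H⁰(L) ≠ 0` THE BASE LOCUS HAS EMPTY INTERIOR** (`Bs|L| ⊆ |(ϑ)|` for any `ϑ ∈ H⁰(L) ∖ 0`):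
`φ_L` is defined on an open dense set. [cite: Lange2023AbelianVarietiesComplex, §2.1.1 (p0077 L19–L26)] [cite: Chirka1989, §2.8 (p. 25)] -/
theorem interior_baseLocus_eq_empty (hη : IsNSForm Φ η) (hχ : IsSemicharacter Φ η χ)
    (hne : thetaFunctions Φ (canonicalFactor Φ η χ) ≠ ⊥) : interior (baseLocus Φ d η χ) = ∅ := by
  obtain ⟨ϑ, hϑ, hϑ0⟩ := (Submodule.ne_bot_iff _).1 hne
  refine subset_empty_iff.1 ?_
  rw [← interior_support_divisorChain_eq_empty Φ d e h hη hχ hϑ hϑ0]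
  exact interior_mono (baseLocus_subset_support Φ d (divisorChain_mem_linearSystem Φ d hϑ hϑ0))

include e h in
/-- **The complement of the base locus is dense** for `H⁰(L) ≠ 0` (`φ_L` is defined on a dense open
subset of `X`). [cite: Lange2023AbelianVarietiesComplex, §2.1.1 (p0077 L19–L26)] -/
theorem dense_compl_baseLocus (hη : IsNSForm Φ η) (hχ : IsSemicharacter Φ η χ)
    (hne : thetaFunctions Φ (canonicalFactor Φ η χ) ≠ ⊥) : Dense (baseLocus Φ d η χ)ᶜ := by
  rw [← interior_eq_empty_iff_dense_compl]
  exact interior_baseLocus_eq_empty Φ d e h hη hχ hne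

include e h in
/-- **`Bs|L| = X ⟺ H⁰(L) = 0`.** [cite: GriffithsHarris1978, Ch. 1 §1 (p. 137)] [cite: Lange2023AbelianVarietiesComplex, §2.1.1 (p0077 L19–L26)] -/
theorem baseLocus_eq_univ_iff (hη : IsNSForm Φ η) (hχ : IsSemicharacter Φ η χ) :
    baseLocus Φ d η χ = univ ↔ thetaFunctions Φ (canonicalFactor Φ η χ) = ⊥ := by
  refine ⟨fun hu => ?_, baseLocus_eq_univ_of_eq_bot Φ d⟩
  by_contra hne
  have h1 := interior_baseLocus_eq_empty Φ d e h hη hχ hne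
  rw [hu, interior_univ] at h1
  exact univ_nonempty.ne_empty h1

include e h in
/-- **`Bs|L| ≠ X` for `H⁰(L) ≠ 0`.** [cite: GriffithsHarris1978, Ch. 1 §1 (p. 137)] -/
theorem baseLocus_ne_univ (hη : IsNSForm Φ η) (hχ : IsSemicharacter Φ η χ)
    (hne : thetaFunctions Φ (canonicalFactor Φ η χ) ≠ ⊥) : baseLocus Φ d η χ ≠ univ :=
  fun hu => hne ((baseLocus_eq_univ_iff Φ d e h hη hχ).1 hu)

end BaseLocusAnalytic

end Literature.Geometry.Kaehler.ComplexTorus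

end
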